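import Summits.AtomisticToContinuum.HydrodynamicLimit.Theorems.AntiMazurCoboundariesCellForecastPressureDecayEntropyBallObjects
import Summits.AtomisticToContinuum.HydrodynamicLimit.Theorems.CellForecastPressureDecay.Negative.WithoutOrthogonality
import Literature.Analysis.FluidPDE.HardSphereEuclideanAlexander
import Literature.Analysis.FluidPDE.HardSphereRegularGeometry
import Literature.Analysis.FluidPDE.BoltzmannGradLimitProofs
import Literature.Analysis.FluidPDE.BBGKYMarginalsProofs
import HarnessLib

/-!
# Cell → torus reduction, piece (B2, first half): the chart of the cube inside the torus and its Jacobian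
# (crux `CellForecastPressureDecay`, stmt-AtomisticToContinuum-13915; line `entropy-ball-invariant-states`,
# stub `stub_torusReduction`, step (i) EMBEDDING of its proof plan)

Put the crux's cube `[0,L]³` inside a torus of side `Λ ≥ L + σ` (cell units; i.e. the unit torus `𝕋³` carrying
`n` spheres of diameter `σ/Λ`). For centres in the cube the torus hard core at diameter `σ/Λ` and the Euclidean
hard core at diameter `σ` COINCIDE (a wrapped image of a cube point is at least `Λ - L ≥ σ` away), so the
canonical cell Gibbs law `cellLaw σ n L` of the crux IS the torus canonical law `torusGibbs (σ/Λ) n`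
conditioned on the cube event. Precisely, with the lift `cubeLift L Λ` (positions: `Λ ·` the symmetric
representative ` + (L/2, L/2, L/2)`; velocities kept) and the cube event `inCube L Λ n = cubeLift ⁻¹' {all
positions in [0,L]³}`, this file proves

* `projConfig_mem_hardSphereDomain_iff` (the geometric heart: in the cube the two hard cores coincide, via
  `le_norm_reprSym_proj_iff` — a nonzero lattice shift of a coordinate of size `≤ 1 - δ` has size `≥ δ`);
* `map_cellAffine_volume` (Jacobian `Λ^{-3n}` of the chart, positions only rescaled);
* `setLIntegral_inCube_comp_cubeLift` — the MASTER CHANGE OF VARIABLES (Haar on `𝕋^{3n}` → Lebesgue on the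
  cell frame): `∫⁻_{inCube} 𝟙_{D^T_{σ/Λ}} ∏M(v_i) · F ∘ cubeLift = Λ^{-3n} ∫⁻ 𝟙_{cube ∩ D^E_σ} ∏M(v_i) · F`.

The conditioning identities themselves are in the sequel `…TorusReductionEmbedding`. All declarations live in
the sub-namespace `…Theorems.EntropyBall.TorusReduction`.
-/

noncomputable section

open MeasureTheory Set Filter
open scoped ENNReal

namespace Summit.AtomisticToContinuum.HydrodynamicLimit.Theorems.EntropyBall

open Literature.MathematicalPhysics.KineticTheory (T3 V3)
open Literature.Analysis.FluidPDE
open Literature.Analysis.FunctionSpaces (Torus.proj)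
open Summit.AtomisticToContinuum.HydrodynamicLimit.Theorems.TiltAnalyticity (Flows cellLaw)
open Summit.AtomisticToContinuum.HydrodynamicLimit.Theorems.CellForecastPressureDecay (cellCube cellRef
  measurableSet_cellCube cellRef_nonneg integrable_cellRef)

namespace TorusReduction

variable {n : ℕ}

/-! ## The chart: lift of torus configurations to the cell frame -/

/-- The centre `(L/2, L/2, L/2)` of the cube `[0,L]³`. -/
def cubeCentre (L : ℝ) : V3 := WithLp.toLp 2 fun _ => L / 2

/-- Coordinates of the centre. -/
@[simp]
theorem cubeCentre_apply (L : ℝ) (k : Fin 3) : cubeCentre L k = L / 2 := rfl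

/-- The affine chart of one position: `y ↦ Λ y + (L/2, L/2, L/2)` (torus units → cell units). -/
def posAffine (L Λ : ℝ) (y : V3) : V3 := Λ • y + cubeCentre L

/-- Coordinates of the affine chart. -/
theorem posAffine_apply (L Λ : ℝ) (y : V3) (k : Fin 3) : posAffine L Λ y k = Λ * y k + L / 2 := by
  simp [posAffine]

/-- The affine chart is continuous. -/
theorem continuous_posAffine (L Λ : ℝ) : Continuous (posAffine L Λ) :=
  (continuous_const_smul Λ).add continuous_const

/-- The affine chart on configurations (positions rescaled and recentred, velocities kept). -/
def cellAffine (L Λ : ℝ) (w : Config n (Fin 3) V3) : Config n (Fin 3) V3 :=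
  fun i => (posAffine L Λ (w i).1, (w i).2)

/-- The affine chart on configurations is measurable. -/
theorem measurable_cellAffine (L Λ : ℝ) : Measurable (cellAffine (n := n) L Λ) :=
  measurable_pi_lambda _ fun i =>
    ((continuous_posAffine L Λ).measurable.comp (measurable_pi_apply i).fst).prodMk
      (measurable_pi_apply i).snd

/-- **The lift** of a torus phase point to the cell frame: positions `Λ · reprSym(q_i) + (L/2,L/2,L/2)`,
velocities unchanged. It is injective, and inverse to the embedding `x ↦ proj ((x - centre)/Λ)` of the cube. -/
def cubeLift (L Λ : ℝ) (z : TorusPhase n) : Config n (Fin 3) V3 :=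
  cellAffine L Λ (Alexander.reprConfig z)

/-- Positions of the lift. -/
theorem cubeLift_apply_fst (L Λ : ℝ) (z : TorusPhase n) (i : Fin n) :
    (cubeLift L Λ z i).1 = posAffine L Λ (Torus.reprSym (z i).1) := rfl

/-- Velocities of the lift. -/
@[simp]
theorem cubeLift_apply_snd (L Λ : ℝ) (z : TorusPhase n) (i : Fin n) : (cubeLift L Λ z i).2 = (z i).2 := rfl

/-- The lift is measurable. -/
theorem measurable_cubeLift (L Λ : ℝ) : Measurable (cubeLift (n := n) L Λ) :=
  (measurable_cellAffine L Λ).comp Alexander.measurePreserving_reprConfig.measurable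

/-- The cube configurations of the cell frame: all positions in `[0,L]³`. -/
def cubeConfigs (L : ℝ) (n : ℕ) : Set (Config n (Fin 3) V3) := {z | ∀ i, (z i).1 ∈ cellCube L}

/-- The set of cube configurations is measurable. -/
theorem measurableSet_cubeConfigs (L : ℝ) (n : ℕ) : MeasurableSet (cubeConfigs L n) := by
  have : cubeConfigs L n = ⋂ i, (fun z : Config n (Fin 3) V3 => (z i).1) ⁻¹' cellCube L := by
    ext z; simp [cubeConfigs]
  rw [this]
  exact MeasurableSet.iInter fun i => (measurableSet_cellCube L).preimage (measurable_pi_apply i).fst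

/-- **The cube event** on the torus phase space: the lift has all its positions in `[0,L]³`. -/
def inCube (L Λ : ℝ) (n : ℕ) : Set (TorusPhase n) := cubeLift L Λ ⁻¹' cubeConfigs L n

/-- The cube event is measurable. -/
theorem measurableSet_inCube (L Λ : ℝ) (n : ℕ) : MeasurableSet (inCube L Λ n) :=
  (measurableSet_cubeConfigs L n).preimage (measurable_cubeLift L Λ)

/-- In the chart, "all positions of `cellAffine w` in the cube" reads `|y_{i,k}| ≤ L/(2Λ)`. -/
theorem cellAffine_mem_cubeConfigs_iff {L Λ : ℝ} (hΛ : 0 < Λ) (w : Config n (Fin 3) V3) :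
    cellAffine L Λ w ∈ cubeConfigs L n ↔ ∀ i k, |(w i).1 k| ≤ L / (2 * Λ) := by
  simp only [cubeConfigs, mem_setOf_eq, cellCube, cellAffine, posAffine_apply, mem_Icc]
  refine forall_congr' fun i => forall_congr' fun k => ?_
  have h2 : (0 : ℝ) < 2 * Λ := by positivity
  rw [abs_le, neg_le, le_div_iff₀ h2, le_div_iff₀ h2]
  constructor
  · rintro ⟨h1, h1'⟩; constructor <;> nlinarith
  · rintro ⟨h1, h1'⟩; constructor <;> nlinarith

/-! ## The geometric heart: in the cube the two hard cores coincide -/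

/-- Each coordinate of the symmetric representative of `proj u` differs from that of `u` by an integer. -/
theorem exists_int_reprSym_proj (u : V3) :
    ∃ k : Fin 3 → ℤ, ∀ m, Torus.reprSym (Torus.proj u) m = u m + k m := by
  obtain ⟨k, hk⟩ := (Literature.Analysis.FunctionSpaces.Torus.proj_eq_proj_iff_holds u
    (Torus.reprSym (Torus.proj u))).1 (Torus.proj_reprSym (Torus.proj u)).symm
  refine ⟨k, fun m => ?_⟩
  rw [hk]
  simp

/-- **Minimal image vs Euclidean length below the wrapping threshold**: if every coordinate of `u` is at most
`1 - δ` in absolute value, then `δ ≤ ‖reprSym (proj u)‖ ↔ δ ≤ ‖u‖` (a nonzero lattice shift of a coordinate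
of size `≤ 1 - δ` has size `≥ δ`). -/
theorem le_norm_reprSym_proj_iff {u : V3} {δ : ℝ} (hu : ∀ m, |u m| ≤ 1 - δ) :
    δ ≤ ‖Torus.reprSym (Torus.proj u)‖ ↔ δ ≤ ‖u‖ := by
  constructor
  · exact fun h => h.trans (Torus.norm_reprSym_le_of_proj_eq rfl)
  · intro h
    obtain ⟨k, hk⟩ := exists_int_reprSym_proj u
    by_cases h0 : ∀ m, k m = 0
    · have : Torus.reprSym (Torus.proj u) = u := by
        ext m; rw [hk m, h0 m]; simp
      rwa [this]
    · obtain ⟨m, hm⟩ := not_forall.1 h0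
      have h1 : (1 : ℝ) ≤ |(k m : ℝ)| := by
        rw [← Int.cast_abs]; exact_mod_cast Int.one_le_abs hm
      have h2 : δ ≤ |Torus.reprSym (Torus.proj u) m| := by
        rw [hk m]
        have := abs_sub_abs_le_abs_sub ((k m : ℝ)) (-(u m))
        rw [abs_neg, sub_neg_eq_add, add_comm] at this
        linarith [hu m]
      exact h2.trans (Torus.abs_reprSym_apply_le_norm _ m)

/-- **In the cube the torus and Euclidean hard cores coincide**: if all chart positions satisfy
`|y_{i,k}| ≤ L/(2Λ)` and `L + σ ≤ Λ`, then the projected configuration is in the torus hard-sphere domain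
at diameter `σ/Λ` iff its affine image is in the Euclidean hard-sphere domain at diameter `σ`. -/
theorem projConfig_mem_hardSphereDomain_iff {σ L Λ : ℝ} (hΛ : 0 < Λ) (hLΛ : L + σ ≤ Λ)
    {w : Config n (Fin 3) V3} (hw : ∀ i k, |(w i).1 k| ≤ L / (2 * Λ)) :
    Alexander.projConfig w ∈ hardSphereDomain (Torus.geometry (Fin 3)) n (σ / Λ) ↔
      cellAffine L Λ w ∈ hardSphereDomain (Euclidean.geometry (Fin 3)) n σ := by
  simp only [mem_hardSphereDomain]
  refine forall_congr' fun i => forall_congr' fun j => forall_congr' fun _ => ?_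
  have hsub : Torus.proj (w i).1 - Torus.proj (w j).1 = Torus.proj ((w i).1 - (w j).1) := by
    rw [sub_eq_add_neg, sub_eq_add_neg, Literature.Analysis.FunctionSpaces.Torus.proj_add,
      Literature.Analysis.FunctionSpaces.Torus.proj_neg]
  have hE : (Euclidean.geometry (Fin 3)).sepVec (cellAffine L Λ w i).1 (cellAffine L Λ w j).1 =
      Λ • ((w i).1 - (w j).1) := by
    simp only [Euclidean.geometry_sepVec, cellAffine, posAffine, smul_sub]
    abel
  rw [Alexander.projConfig_apply_fst, Alexander.projConfig_apply_fst, Torus.geometry_sepVec, hsub, hE,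
    norm_smul, Real.norm_eq_abs, abs_of_pos hΛ, ← div_le_iff₀' hΛ]
  refine le_norm_reprSym_proj_iff fun m => ?_
  have h1 := hw i m
  have h2 := hw j m
  have h3 : |((w i).1 - (w j).1) m| ≤ L / Λ := by
    rw [PiLp.sub_apply]
    calc |(w i).1 m - (w j).1 m| ≤ |(w i).1 m| + |(w j).1 m| := abs_sub _ _
      _ ≤ L / (2 * Λ) + L / (2 * Λ) := add_le_add h1 h2
      _ = L / Λ := by field_simp; ring
  refine h3.trans ?_
  rw [le_sub_iff_add_le, ← add_div, div_le_one hΛ]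
  exact hLΛ

/-- Chart positions with `|y_{i,k}| ≤ L/(2Λ) < 1/2` lie in the chart cube `(-1/2, 1/2]^{3n}`. -/
theorem mem_chartCube_of_abs_le {L Λ : ℝ} (hΛ : 0 < Λ) (hLΛ : L < Λ) {w : Config n (Fin 3) V3}
    (hw : ∀ i k, |(w i).1 k| ≤ L / (2 * Λ)) : w ∈ Alexander.chartCube n (Fin 3) := by
  intro i k
  have h := hw i k
  have hlt : L / (2 * Λ) < 1 / 2 := by
    rw [div_lt_iff₀ (by positivity)]; linarith
  rw [abs_le] at h
  constructor <;> linarith [h.1, h.2]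

/-! ## The change of variables -/

/-- The product of `n` copies of a scaled measure: `⨂ (a • μ) = aⁿ • ⨂ μ`. -/
theorem pi_const_smul_fin {α : Type*} [MeasurableSpace α] (μ : Measure α) [SigmaFinite μ] {a : ℝ≥0∞}
    (ha : a ≠ ∞) (n : ℕ) : (Measure.pi fun _ : Fin n => a • μ) = a ^ n • Measure.pi fun _ : Fin n => μ := by
  haveI : SigmaFinite (a • μ) := by
    rw [← ENNReal.coe_toNNReal ha, Measure.coe_nnreal_smul]; infer_instance
  refine Measure.pi_eq (μ := fun _ : Fin n => a • μ) fun s _ => ?_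
  simp only [Measure.smul_apply, smul_eq_mul, Measure.pi_pi, Finset.prod_mul_distrib,
    Finset.prod_const, Finset.card_univ, Fintype.card_fin]

/-- The affine chart of one position pushes Lebesgue measure to `Λ^{-3} ·` Lebesgue measure. -/
theorem map_posAffine_volume {L Λ : ℝ} (hΛ : 0 < Λ) :
    Measure.map (posAffine L Λ) (volume : Measure V3) = ENNReal.ofReal ((Λ ^ 3)⁻¹) • volume := by
  have h1 : posAffine L Λ = (fun y : V3 => y + cubeCentre L) ∘ fun y : V3 => Λ • y := rfl
  rw [h1, ← Measure.map_map (measurable_add_const _) (measurable_const_smul Λ),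
    Measure.map_addHaar_smul volume hΛ.ne', Measure.map_smul, map_add_right_eq_self,
    finrank_euclideanSpace_fin, abs_of_pos (inv_pos.2 (pow_pos hΛ 3))]

/-- On one-particle phase space the chart pushes Lebesgue measure to `Λ^{-3} ·` Lebesgue measure. -/
theorem map_phaseAffine_volume {L Λ : ℝ} (hΛ : 0 < Λ) :
    Measure.map (Prod.map (posAffine L Λ) (id : V3 → V3)) (volume : Measure (V3 × V3)) =
      ENNReal.ofReal ((Λ ^ 3)⁻¹) • volume := by
  rw [Measure.volume_eq_prod, ← Measure.map_prod_map _ _ (continuous_posAffine L Λ).measurable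
    measurable_id, map_posAffine_volume hΛ, Measure.map_id, Measure.prod_smul_left]

/-- **Jacobian of the chart**: `cellAffine L Λ` pushes Lebesgue measure on the `n`-particle cell phase space
to `Λ^{-3n} ·` Lebesgue measure. -/
theorem map_cellAffine_volume {L Λ : ℝ} (hΛ : 0 < Λ) :
    Measure.map (cellAffine (n := n) L Λ) volume = ENNReal.ofReal ((Λ ^ 3)⁻¹) ^ n • volume := by
  set a : ℝ≥0∞ := ENNReal.ofReal ((Λ ^ 3)⁻¹) with ha_def
  have ha : a ≠ ∞ := ENNReal.ofReal_ne_top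
  have hσ : SigmaFinite (a • (volume : Measure (V3 × V3))) := by
    rw [← ENNReal.coe_toNNReal ha, Measure.coe_nnreal_smul]; infer_instance
  have hinst : ∀ _i : Fin n, SigmaFinite ((volume : Measure (V3 × V3)).map
      (Prod.map (posAffine L Λ) (id : V3 → V3))) := fun _ => by
    rw [map_phaseAffine_volume hΛ]; exact hσ
  have h := Measure.pi_map_pi (μ := fun _ : Fin n => (volume : Measure (V3 × V3)))
    (f := fun _ => Prod.map (posAffine L Λ) (id : V3 → V3)) (hμ := hinst)
    (fun _ => ((continuous_posAffine L Λ).measurable.prodMap measurable_id).aemeasurable)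
  rw [MeasureTheory.volume_pi]
  change (Measure.pi fun _ : Fin n => (volume : Measure (V3 × V3))).map
    (fun w i => Prod.map (posAffine L Λ) id (w i)) = _
  rw [h]
  simp_rw [map_phaseAffine_volume hΛ]
  exact pi_const_smul_fin _ ha n

/-- Change of variables under the chart: `∫⁻ ψ ∘ cellAffine = Λ^{-3n} ∫⁻ ψ`. -/
theorem lintegral_comp_cellAffine {L Λ : ℝ} (hΛ : 0 < Λ) {ψ : Config n (Fin 3) V3 → ℝ≥0∞}
    (hψ : Measurable ψ) :
    ∫⁻ w, ψ (cellAffine L Λ w) = ENNReal.ofReal ((Λ ^ 3)⁻¹) ^ n * ∫⁻ z, ψ z := by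
  rw [← lintegral_map hψ (measurable_cellAffine L Λ), map_cellAffine_volume hΛ, lintegral_smul_measure,
    smul_eq_mul]

/-- **Master change of variables (Haar on the torus → Lebesgue on the cell frame).** For `L + σ ≤ Λ`, `σ > 0`
and measurable `F ≥ 0`:
`∫⁻_{inCube} 𝟙_{D^T_{σ/Λ}}(ẑ) ∏ M(v_i) · F(cubeLift ẑ) dẑ = Λ^{-3n} ∫⁻ 𝟙_{cube ∩ D^E_σ}(z) ∏ M(v_i) · F(z) dz`. -/
theorem setLIntegral_inCube_comp_cubeLift {σ L Λ : ℝ} (hσ : 0 < σ) (hΛ : 0 < Λ) (hLΛ : L + σ ≤ Λ)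
    {F : Config n (Fin 3) V3 → ℝ≥0∞} (hF : Measurable F) :
    ∫⁻ z in inCube L Λ n, (hardSphereDomain (Torus.geometry (Fin 3)) n (σ / Λ)).indicator
        (fun z => ENNReal.ofReal (∏ i, globalMaxwellian (z i).2)) z * F (cubeLift L Λ z) =
      ENNReal.ofReal ((Λ ^ 3)⁻¹) ^ n *
        ∫⁻ z, (cubeConfigs L n ∩ hardSphereDomain (Euclidean.geometry (Fin 3)) n σ).indicator
          (fun z => ENNReal.ofReal (∏ i, globalMaxwellian (z i).2)) z * F z := by
  have hLΛ' : L < Λ := by linarith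
  set DT : Set (TorusPhase n) := hardSphereDomain (Torus.geometry (Fin 3)) n (σ / Λ) with hDT_def
  set DE : Set (Config n (Fin 3) V3) := hardSphereDomain (Euclidean.geometry (Fin 3)) n σ with hDE_def
  set MT : TorusPhase n → ℝ≥0∞ := fun z => ENNReal.ofReal (∏ i, globalMaxwellian (z i).2) with hMT
  set ME : Config n (Fin 3) V3 → ℝ≥0∞ := fun z => ENNReal.ofReal (∏ i, globalMaxwellian (z i).2) with hME
  -- the integrand on the chart cube
  set φ : Config n (Fin 3) V3 → ℝ≥0∞ := fun w =>
    (cellAffine L Λ ⁻¹' cubeConfigs L n).indicator (fun w =>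
      (Alexander.projConfig ⁻¹' DT).indicator ME w * F (cellAffine L Λ w)) w with hφ
  set ψ : Config n (Fin 3) V3 → ℝ≥0∞ := fun z => (cubeConfigs L n ∩ DE).indicator ME z * F z with hψ
  have hMEm : Measurable ME :=
    (Finset.measurable_prod _ fun i _ =>
      continuous_globalMaxwellian.measurable.comp (measurable_pi_apply i).snd).ennreal_ofReal
  have hDTm : MeasurableSet DT := measurableSet_hardSphereDomain _ Torus.measurable_geometry_sepVec n _
  have hDEm : MeasurableSet DE := measurableSet_hardSphereDomain _ Euclidean.measurable_geometry_sepVec n _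
  have hφm : Measurable φ := by
    refine Measurable.indicator ?_ ((measurableSet_cubeConfigs L n).preimage (measurable_cellAffine L Λ))
    exact (hMEm.indicator (hDTm.preimage Alexander.measurable_projConfig)).mul
      (hF.comp (measurable_cellAffine L Λ))
  have hψm : Measurable ψ := (hMEm.indicator ((measurableSet_cubeConfigs L n).inter hDEm)).mul hF
  -- (1) rewrite the torus integral as `∫⁻ φ ∘ reprConfig`
  have h1 : ∫⁻ z in inCube L Λ n, DT.indicator MT z * F (cubeLift L Λ z) =
      ∫⁻ z, φ (Alexander.reprConfig z) := by
    rw [← lintegral_indicator (measurableSet_inCube L Λ n)]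
    refine lintegral_congr fun z => ?_
    have hz : Alexander.projConfig (Alexander.reprConfig z) = z := Alexander.projConfig_reprConfig z
    have hind : (Alexander.projConfig ⁻¹' DT).indicator ME (Alexander.reprConfig z) = DT.indicator MT z := by
      by_cases hD : z ∈ DT
      · rw [indicator_of_mem hD, indicator_of_mem
          (show Alexander.reprConfig z ∈ Alexander.projConfig ⁻¹' DT by rw [mem_preimage, hz]; exact hD)]
        rfl
      · rw [indicator_of_notMem hD, indicator_of_notMem
          (show Alexander.reprConfig z ∉ Alexander.projConfig ⁻¹' DT by rw [mem_preimage, hz]; exact hD)]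
    by_cases hc : z ∈ inCube L Λ n
    · rw [indicator_of_mem hc, hφ]
      dsimp only
      rw [indicator_of_mem (show Alexander.reprConfig z ∈ cellAffine L Λ ⁻¹' cubeConfigs L n from hc), hind]
      rfl
    · rw [indicator_of_notMem hc, hφ]
      dsimp only
      rw [indicator_of_notMem (show Alexander.reprConfig z ∉ cellAffine L Λ ⁻¹' cubeConfigs L n from hc)]
  -- (2) Haar → Lebesgue on the chart cube, and drop the restriction (φ vanishes off the chart cube)
  have h2 : ∫⁻ z, φ (Alexander.reprConfig z) = ∫⁻ w, φ w := by
    rw [Alexander.measurePreserving_reprConfig.lintegral_comp hφm, ← lintegral_indicator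
      Alexander.measurableSet_chartCube]
    refine lintegral_congr fun w => ?_
    by_cases hw : w ∈ cellAffine L Λ ⁻¹' cubeConfigs L n
    · rw [indicator_of_mem (mem_chartCube_of_abs_le hΛ hLΛ'
        ((cellAffine_mem_cubeConfigs_iff hΛ w).1 hw))]
    · have h0 : φ w = 0 := by rw [hφ]; exact indicator_of_notMem hw _
      by_cases hc : w ∈ Alexander.chartCube n (Fin 3)
      · rw [indicator_of_mem hc]
      · rw [indicator_of_notMem hc, h0]
  -- (3) pointwise, `φ = ψ ∘ cellAffine` (the two hard cores coincide in the cube)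
  have h3 : ∀ w, φ w = ψ (cellAffine L Λ w) := by
    intro w
    rw [hφ, hψ]
    dsimp only
    by_cases hw : w ∈ cellAffine L Λ ⁻¹' cubeConfigs L n
    · have hw' := (cellAffine_mem_cubeConfigs_iff hΛ w).1 hw
      rw [indicator_of_mem hw]
      congr 1
      by_cases hD : Alexander.projConfig w ∈ DT
      · rw [indicator_of_mem (show w ∈ Alexander.projConfig ⁻¹' DT from hD), indicator_of_mem
          (show cellAffine L Λ w ∈ cubeConfigs L n ∩ DE from
            ⟨hw, (projConfig_mem_hardSphereDomain_iff hΛ hLΛ hw').1 hD⟩)]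
        rfl
      · rw [indicator_of_notMem (show w ∉ Alexander.projConfig ⁻¹' DT from hD), indicator_of_notMem
          (show cellAffine L Λ w ∉ cubeConfigs L n ∩ DE from
            fun h => hD ((projConfig_mem_hardSphereDomain_iff hΛ hLΛ hw').2 h.2))]
    · rw [indicator_of_notMem hw, indicator_of_notMem (show cellAffine L Λ w ∉ cubeConfigs L n ∩ DE from
        fun h => hw h.1), zero_mul]
  rw [h1, h2]
  simp_rw [h3]
  exact lintegral_comp_cellAffine hΛ hψm

end TorusReduction

/-- **Registered helper stub `stub_trChart`** (piece (B2, chart) of `stub_torusReduction`: in the cube the torus and Euclidean hard cores coincide, and the master change of variables Haar → Lebesgue under the lift `cubeLift` (Jacobian `Λ^{-3n}`)): the conjunction of this file's main results, closed. -/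
theorem stub_trChart : (∀ (n : ℕ) (σ L Λ : ℝ), 0 < Λ → L + σ ≤ Λ → ∀ w : Literature.Analysis.FluidPDE.Config n (Fin 3) Literature.MathematicalPhysics.KineticTheory.V3, (∀ i k, |(w i).1 k| ≤ L / (2 * Λ)) → (Literature.Analysis.FluidPDE.Alexander.projConfig w ∈ Literature.Analysis.FluidPDE.hardSphereDomain (Literature.Analysis.FluidPDE.Torus.geometry (Fin 3)) n (σ / Λ) ↔ Summit.AtomisticToContinuum.HydrodynamicLimit.Theorems.EntropyBall.TorusReduction.cellAffine L Λ w ∈ Literature.Analysis.FluidPDE.hardSphereDomain (Literature.Analysis.FluidPDE.Euclidean.geometry (Fin 3)) n σ)) ∧ (∀ (n : ℕ) (σ L Λ : ℝ), 0 < σ → 0 < Λ → L + σ ≤ Λ → ∀ F : Literature.Analysis.FluidPDE.Config n (Fin 3) Literature.MathematicalPhysics.KineticTheory.V3 → ENNReal, Measurable F → ∫⁻ z in Summit.AtomisticToContinuum.HydrodynamicLimit.Theorems.EntropyBall.TorusReduction.inCube L Λ n, (Literature.Analysis.FluidPDE.hardSphereDomain (Literature.Analysis.FluidPDE.Torus.geometry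 (Fin 3)) n (σ / Λ)).indicator (fun z => ENNReal.ofReal (∏ i, Literature.Analysis.FluidPDE.globalMaxwellian (z i).2)) z * F (Summit.AtomisticToContinuum.HydrodynamicLimit.Theorems.EntropyBall.TorusReduction.cubeLift L Λ z) = ENNReal.ofReal ((Λ ^ 3)⁻¹) ^ n * ∫⁻ z, (Summit.AtomisticToContinuum.HydrodynamicLimit.Theorems.EntropyBall.TorusReduction.cubeConfigs L n ∩ Literature.Analysis.FluidPDE.hardSphereDomain (Literature.Analysis.FluidPDE.Euclidean.geometry (Fin 3)) n σ).indicator (fun z => ENNReal.ofReal (∏ i, Literature.Analysis.FluidPDE.globalMaxwellian (z i).2)) z * F z) :=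
  ⟨fun _ _ _ _ hΛ hLΛ _ hw => TorusReduction.projConfig_mem_hardSphereDomain_iff hΛ hLΛ hw,
    fun _ _ _ _ hσ hΛ hLΛ _ hF => TorusReduction.setLIntegral_inCube_comp_cubeLift hσ hΛ hLΛ hF⟩


end Summit.AtomisticToContinuum.HydrodynamicLimit.Theorems.EntropyBall

end
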